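import Summits.BirchSwinnertonDyer.BirchSwinnertonDyer.Theorems.SchneiderFreeAdditiveX3LocalTowerTorsionLine
import Summits.BirchSwinnertonDyer.Rank1Residual.X11b.AnticyclotomicLocalTorsionDescent
import Literature.NumberTheory.EllipticCurves.WeilPairingProofs
import Literature.NumberTheory.EllipticCurves.TorsionCardinality
import Literature.AnabelianGeometry.EtaleTheta.RootsOfUnityPadicOrders
import HarnessLib

/-!
# The local tower group moves a `p`-torsion point: input (ii) of the line-free Fin_v reduction,
# from the Weil pairing and `μ_p ⊄ K_𝔭`

Seat `bsd-potss-kmc`, gen 16 (cell `bsd-potss`). Helper for crux #5 `WildSplitControlAtThree` of route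
`UniversalToricDescent` (stmt-BirchSwinnertonDyer-20386): it DISCHARGES hypothesis (ii) `hMove` of
`UniversalToricDescentControl.wildSplitControlAtThree_of_facts_of_noStableDivisibleLine` /
`WeierstrassCurve.localTowerTorsionFiniteAt_of_noStableDivisibleLine`.

* `WeierstrassCurve.exists_pTorsion_not_fixed_of_no_primitiveRoot` — for an elliptic `E/K` (`K` a
  number field), a prime `p`, ANY `ℤ_p`-extension `κ` and a finite place `𝔭` whose completion `K_𝔭`
  contains NO primitive `p`-th root of unity: some `p`-torsion point of `E(K̄)` is moved by the local
  tower group `D_𝔭 ⊓ ker κ`.  Proof: otherwise `D_𝔭 ⊓ ker κ` fixes `E[p]`, hence (Galois-equivariance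
  of the Weil pairing, `exists_weilPairing_holds`) fixes a primitive `p`-th root of unity
  `ζ = e_p(S, T) ∈ K̄`; the stabiliser of `ζ` is open, so (compactness along the layers of `κ`) some
  `D_𝔭 ⊓ κ⁻¹(pⁿℤ_p)` fixes `ζ`; for `d ∈ D_𝔭` write `d ζ = ζ^a`: then `d^{pⁿ} ζ = ζ^{a^{pⁿ}} = ζ` and
  `a^{pⁿ} ≡ a (mod p)` (Fermat) give `d ζ = ζ`; so `D_𝔭 = res(Γ_{K_𝔭})` fixes `ζ`, i.e. `ζ ∈ K_𝔭`
  (`InfiniteGalois.mem_range_algebraMap_iff_fixed`) — a primitive `p`-th root of unity in `K_𝔭`.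
* `WeierstrassCurve.exists_pTorsion_not_fixed_of_degreeOne` — the case of a degree-one `𝔭 ∣ p` with
  `p` odd: `K_𝔭 ↪ ℚ_p` (`X11b.exists_ringHom_adicCompletion_padic_of_degreeOne`) and `ℚ_p` has no
  primitive `p`-th root of unity for odd `p` (`exists_isPrimitiveRoot_padic_iff_dvd_pred`, Serre,
  *Cours d'arithmétique* II §3.1 Prop. 7).

Proofs only (no definition, no named fact, no `sorry`); closes nothing by itself; BSD is not advanced.

References: [SilvermanAEC2009] Prop. III.8.1 (Weil pairing) and Cor. III.8.1.1; [Serre1973] Ch. II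
§3.1 Prop. 7; [Washington1997] §13.1 (layers of a `ℤ_p`-extension); [GreenbergLNM1716] §3 Lemma 3.3.
-/

noncomputable section

open scoped Classical

namespace WeierstrassCurve

open NumberField IsDedekindDomain Field Literature.NumberTheory.EllipticCurves
  Literature.NumberTheory.EllipticCurves.GreenbergSelmer
  Literature.NumberTheory.GaloisRepresentations
  Summit.BirchSwinnertonDyer.Rank1Residual.X11b
  Summit.BirchSwinnertonDyer.Rank1Residual.X11b.AcSelmer
  Summit.BirchSwinnertonDyer.BirchSwinnertonDyer.Theorems.SchneiderFreeAdditiveX3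

variable {K : Type} [Field K] [NumberField K] (E : WeierstrassCurve K) (p : ℕ)
  [hp : Fact p.Prime] (κ : ZpExtension K p) (𝔭 : HeightOneSpectrum (𝓞 K))

/-- **The local tower group moves a `p`-torsion point when `μ_p ⊄ K_𝔭`.** For an elliptic curve `E`
over a number field `K`, a prime `p`, a `ℤ_p`-extension `κ` of `K` and a finite place `𝔭` such that the
completion `K_𝔭` contains no primitive `p`-th root of unity, there is a `p`-torsion point of `E(K̄)`
NOT fixed by `D_𝔭 ⊓ ker κ` (the decomposition group, in `Gal(K̄/K_∞)`, of the chosen prime above `𝔭`).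
Otherwise the Weil pairing gives a primitive `p`-th root of unity `ζ` fixed by `D_𝔭 ⊓ ker κ`, the
pro-`p` quotient `D_𝔭/(D_𝔭 ⊓ ker κ)` acts on `μ_p` trivially (`a^{pⁿ} ≡ a (mod p)`), so `D_𝔭` fixes
`ζ` and `ζ ∈ K_𝔭`. [cite: SilvermanAEC2009, Prop. III.8.1 and Cor. III.8.1.1]
[cite: Washington1997, §13.1] -/
theorem exists_pTorsion_not_fixed_of_no_primitiveRoot [E.IsElliptic]
    (hμ : ∀ z : 𝔭.adicCompletion K, ¬ IsPrimitiveRoot z p) :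
    ∃ m : E.geomPrimaryTorsion p, p • m = 0 ∧ ∃ g ∈ decomp 𝔭 ⊓ κ.kerSubgroup, g • m ≠ m := by
  have hpr : p.Prime := hp.out
  by_contra hcon
  push Not at hcon
  -- every geometric `p`-torsion point is fixed by `H = D_𝔭 ⊓ ker κ`
  set H : Subgroup (absoluteGaloisGroup K) := decomp 𝔭 ⊓ κ.kerSubgroup with hH
  have hfixT : ∀ (S : E.geomTorsion (p : ℤ)) (g : absoluteGaloisGroup K), g ∈ H → g • S = S := by
    intro S g hg
    have hS : (p : ℕ) • (S : E.geomPoints) = 0 := AddSubgroup.torsionBy.nsmul_iff.mp S.2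
    set m : E.geomPrimaryTorsion p := ⟨(S : E.geomPoints), ⟨1, by rw [pow_one]; exact hS⟩⟩ with hm
    have hpm : p • m = 0 := Subtype.ext (by
      rw [AddSubgroupClass.coe_nsmul, ZeroMemClass.coe_zero]; exact hS)
    have h := congrArg (fun x : E.geomPrimaryTorsion p ↦ (x : E.geomPoints)) (hcon m hpm g hg)
    simp only [primaryComponent.coe_smul] at h
    exact Subtype.ext (by rw [AddSubgroup.torsionBy.coe_smul]; exact h)
  -- the Weil pairing and a primitive `p`-th root of unity `ζ = e(S₀, T₀)`
  have hpK : ((p : ℕ) : K) ≠ 0 := Nat.cast_ne_zero.mpr hpr.ne_zero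
  obtain ⟨w, hpow, haddl, -, -, hnd, hgal⟩ := E.exists_weilPairing_holds p hpr.two_le hpK
  have hpKbar : ((p : ℕ) : AlgebraicClosure K) ≠ 0 := Nat.cast_ne_zero.mpr hpr.ne_zero
  have hgeom : Nat.card (E.geomTorsion p) = p ^ 2 :=
    card_torsionBy_eq_sq (E := E.baseChange (AlgebraicClosure K)) hpKbar
  haveI : Finite (E.geomTorsion p) :=
    Nat.finite_of_card_ne_zero (by rw [hgeom]; exact pow_ne_zero 2 hpr.ne_zero)
  have hnt : Nontrivial (E.geomTorsion p) := by
    rw [← Finite.one_lt_card_iff_nontrivial, hgeom]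
    exact Nat.one_lt_pow two_ne_zero hpr.one_lt
  obtain ⟨T₀, hT₀⟩ := exists_ne (0 : E.geomTorsion p)
  obtain ⟨S₀, hS₀⟩ : ∃ S₀, w S₀ T₀ ≠ 1 := by
    by_contra h
    exact hT₀ (hnd T₀ fun S => by
      by_contra h'
      exact h ⟨S, h'⟩)
  set ζ : AlgebraicClosure K := w S₀ T₀ with hζdef
  have hζp : ζ ^ p = 1 := hpow S₀ T₀
  have hζprim : IsPrimitiveRoot ζ p := by
    have h := IsPrimitiveRoot.orderOf ζ
    rwa [orderOf_eq_prime hζp hS₀] at h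
  -- `H` fixes `ζ`
  have hHζ : ∀ g ∈ H, g • ζ = ζ := fun g hg ↦ by
    rw [hζdef, hgal g S₀ T₀, hfixT S₀ g hg, hfixT T₀ g hg]
  -- the stabiliser of `ζ` is open: it contains `Gal(K̄/K(ζ))`
  set V : Subgroup (absoluteGaloisGroup K) := MulAction.stabilizer (absoluteGaloisGroup K) ζ with hV
  have hVopen : IsOpen (V : Set (absoluteGaloisGroup K)) := by
    haveI : FiniteDimensional K (IntermediateField.adjoin K {ζ}) :=
      IntermediateField.adjoin.finiteDimensional (Algebra.IsIntegral.isIntegral ζ)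
    refine Subgroup.isOpen_mono ?_ (IntermediateField.fixingSubgroup_isOpen (IntermediateField.adjoin K {ζ}))
    intro g hg
    rw [MulAction.mem_stabilizer_iff]
    exact (IntermediateField.mem_fixingSubgroup_iff _ _).mp hg ζ
      (IntermediateField.mem_adjoin_simple_self K ζ)
  -- some layer of `D_𝔭` fixes `ζ`
  obtain ⟨n, hn⟩ := exists_layerSubgroup_inf_subset κ (decomp 𝔭) (isClosed_decomp 𝔭) hVopen
    (fun g hg ↦ by
      show g ∈ (V : Set (absoluteGaloisGroup K))
      rw [SetLike.mem_coe, MulAction.mem_stabilizer_iff]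
      exact hHζ g hg)
  -- hence `D_𝔭` fixes `ζ`
  have hDζ : ∀ d ∈ decomp 𝔭, d • ζ = ζ := by
    intro d hd
    -- `d ζ = ζ^a`
    have hdp : (d • ζ) ^ p = 1 := by rw [← smul_pow', hζp, smul_one]
    obtain ⟨a, -, ha⟩ := hζprim.eq_pow_of_pow_eq_one hdp
    -- `d^k ζ = ζ^(a^k)`
    have hiter : ∀ k : ℕ, d ^ k • ζ = ζ ^ (a ^ k) := by
      intro k
      induction k with
      | zero => rw [pow_zero, one_smul, pow_zero, pow_one]
      | succ k ih => rw [pow_succ, mul_smul, ← ha, smul_pow', ih, ← pow_mul, ← pow_succ]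
    -- `d^(p^n)` fixes `ζ`
    have hfix : d ^ (p ^ n) • ζ = ζ := by
      have hmem : d ^ (p ^ n) ∈ decomp 𝔭 ⊓ κ.layerSubgroup n :=
        Subgroup.mem_inf.mpr ⟨(decomp 𝔭).pow_mem hd _, pow_prime_pow_mem_layerSubgroup κ d n⟩
      have := hn _ hmem
      rw [SetLike.mem_coe, MulAction.mem_stabilizer_iff] at this
      exact this
    rw [hiter] at hfix
    -- Fermat: `a^(p^n) ≡ a (mod p)`, so `ζ^a = ζ^(a^(p^n)) = ζ`
    have hF' : ∀ k : ℕ, (a : ZMod p) ^ (p ^ k) = (a : ZMod p) := by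
      intro k
      induction k with
      | zero => rw [pow_zero, pow_one]
      | succ k ih => rw [pow_succ, pow_mul, ih, ZMod.pow_card]
    have hF : a ^ (p ^ n) ≡ a [MOD p] := by
      rw [← ZMod.natCast_eq_natCast_iff, Nat.cast_pow]
      exact hF' n
    have hle : a ≤ a ^ (p ^ n) := by
      rcases Nat.eq_zero_or_pos a with rfl | hapos
      · simp
      · exact Nat.le_self_pow (pow_ne_zero n hpr.ne_zero) a
    obtain ⟨t, ht⟩ := (Nat.modEq_iff_dvd' hle).mp hF.symm
    have hdecomp : a ^ (p ^ n) = a + p * t := by omega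
    rw [← ha]
    calc ζ ^ a = ζ ^ a * (ζ ^ p) ^ t := by rw [hζp, one_pow, mul_one]
      _ = ζ ^ (a ^ (p ^ n)) := by rw [hdecomp, pow_add, pow_mul]
      _ = ζ := hfix
  -- so `Γ_{K_𝔭}` fixes `ι ζ`, i.e. `ι ζ ∈ K_𝔭`
  set L := 𝔭.adicCompletion K with hL
  haveI : CharZero L := charZero_of_injective_algebraMap (algebraMap K L).injective
  haveI : IsGalois L (AlgebraicClosure L) :=
    @IsAlgClosure.isGalois L (AlgebraicClosure L) _ _ (AlgebraicClosure.instAlgebra L) inferInstance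
      inferInstance
  set ι := absClosureEmbedding K L with hι
  have hfixι : ∀ σ : (AlgebraicClosure L ≃ₐ[L] AlgebraicClosure L), σ (ι ζ) = ι ζ := fun σ ↦ by
    have h := absGaloisRestrict_apply_smul K L σ ζ
    have hd : (absGaloisRestrict K L σ : absoluteGaloisGroup K) ∈ decomp 𝔭 := ⟨σ, rfl⟩
    have h2 : absGaloisRestrict K L σ • ζ = ζ := hDζ _ hd
    rw [h2] at h
    rw [← hι] at h
    exact h.symm
  obtain ⟨z, hz⟩ := (InfiniteGalois.mem_range_algebraMap_iff_fixed (ι ζ)).mpr hfixι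
  -- `z` is a primitive `p`-th root of unity in `K_𝔭`
  have hιζ : IsPrimitiveRoot (ι ζ) p := hζprim.map_of_injective ι.toRingHom.injective
  rw [← hz] at hιζ
  exact hμ z (hιζ.of_map_of_injective (algebraMap L (AlgebraicClosure L)).injective)

/-- **At a degree-one prime above an odd `p` the local tower group moves a `p`-torsion point.** For
`K` a number field, `p` odd, `𝔭 ∣ p` with `e(𝔭|p) = f(𝔭|p) = 1` (so `K_𝔭 ↪ ℚ_p`), any `ℤ_p`-extension
`κ` and any elliptic `E/K`: some `p`-torsion point of `E(K̄)` is moved by `D_𝔭 ⊓ ker κ` — since `ℚ_p`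
has no primitive `p`-th root of unity for odd `p` (Serre, *Cours d'arithmétique* II §3.1 Prop. 7: the
roots of unity of `ℚ_p` of order prime to `p` form `μ_{p−1}`, and `p ∤ p − 1`). This is hypothesis
`hMove` of `UniversalToricDescentControl.wildSplitControlAtThree_of_facts_of_noStableDivisibleLine` at
every frame of the UTD cell (`K` imaginary quadratic, `3` split). [cite: Serre1973, Ch. II §3.1 Prop. 7]
[cite: SilvermanAEC2009, Cor. III.8.1.1] -/
theorem exists_pTorsion_not_fixed_of_degreeOne [E.IsElliptic] (hp2 : p ≠ 2)
    (h𝔭 : ((p : ℕ) : 𝓞 K) ∈ 𝔭.asIdeal) (he : 𝔭.asIdeal.ramificationIdx (𝓞 ℚ) = 1)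
    (hf : 𝔭.asIdeal.inertiaDeg (𝓞 ℚ) = 1) :
    ∃ m : E.geomPrimaryTorsion p, p • m = 0 ∧ ∃ g ∈ decomp 𝔭 ⊓ κ.kerSubgroup, g • m ≠ m := by
  have hpr : p.Prime := hp.out
  obtain ⟨e⟩ := exists_ringHom_adicCompletion_padic_of_degreeOne p 𝔭 h𝔭 he hf
  refine E.exists_pTorsion_not_fixed_of_no_primitiveRoot p κ 𝔭 fun z hz ↦ ?_
  have hz' : IsPrimitiveRoot (e z) p := hz.map_of_injective e.injective
  have hdvd : p ∣ p - 1 :=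
    (Literature.AnabelianGeometry.EtaleTheta.exists_isPrimitiveRoot_padic_iff_dvd_pred p hp2
      hpr.ne_zero).mp ⟨e z, hz'⟩
  have : p ≤ p - 1 := Nat.le_of_dvd (by have := hpr.two_le; omega) hdvd
  have := hpr.two_le
  omega

end WeierstrassCurve

end
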